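import Summits.NavierStokesRegularity.FunctionalMining.VorticityMomentRegBalance
import HarnessLib

/-!
# FunctionalMining — the `‖ω‖_∞` rate rows `E.q|T_C|C1` of `Z_q = ∫|ω|^q` for EVERY real `q > 1`

Search for candidate a priori estimates; no regularity claim. Cell `pub-nsfunc`, prove seat (gen 13). Second of two
files (vorticity twin of `StrainMomentRateSupAll`): `VorticityMomentRateSup` did the rows
`E.q|T_C|C1` for real `q > 2` through the exact `Z_q` balance; here the singular-weight range
`1 < q < 2` (and, uniformly, every real `q > 1`) is reached through the regularised moments
`F_ε(s) = ∫ (|ω(u s)|² + ε)^{q/2}` (`VorticityMomentRegBalance`: `Ḟ_ε ≤ C M F_ε` on windows with a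
uniform majorant), the tube-lemma localisation, Grönwall by monotonicity, `ε → 0⁺` and the slope
comparison (the three real-variable lemmas of `StrainMomentRateSupAll`):
**for every real `q > 1` there is `C ≥ 0` with `FunctionalRateSupBound (torusVorticityMoment q) C`
on `T³`** (`functionalRateSupBound_of_one_lt`); literally the singular-weight row `E.q=3/2|T_C|C1`
(`functionalRateSupBound_three_halves`). CONTROL rows (closing them needs `∫‖ω‖_∞ dt < ∞`,
Beale–Kato–Majda); existential constants; the value is the kernel check on the whole range
`1 < q < ∞` (K0 `multipliers.C1.holder`: "`E.q|T_C|C1` control for every `q`").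
-/

noncomputable section

open MeasureTheory Finset Set Filter Topology
open scoped InnerProductSpace RealInnerProductSpace ContDiff

namespace Summit.NavierStokesRegularity.FunctionalMining

open Literature.Analysis.FunctionSpaces Literature.Analysis.FunctionSpaces.Torus
  Literature.Analysis.FluidPDE

namespace VorticityMoment

open VorticityL4 StrainMoment
/-! ## 3. Rows `E.q|T_C|C1` for every real `q > 1` -/

/-- **Rows `E.q|T_C|C1` HOLD with some constant for EVERY real `q > 1` (kernel, control rows), on
`T³`.** There is `C ≥ 0` with `FunctionalRateSupBound (torusVorticityMoment q) C`: along every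
classical solution of unforced Navier–Stokes/Euler (`ν ≥ 0`) on `[a, b]`, at every time `t` and for
every pointwise vorticity majorant `M ≥ 0`, every one-sided derivative value `R` of `s ↦ Z_q(u s)`
within `[a, b]` at `t` satisfies `R ≤ C · M · Z_q(u t)`; `C = q√2K₁^{1/q}` (existential vorticity
Calderón–Zygmund constant at `2q`). Regularised moments, tube lemma, Grönwall by monotonicity,
`ε → 0⁺`, slopes — as in `StrainMomentRateSupAll`. [ours; K0 `C1.holder`, tree inputs] -/
theorem functionalRateSupBound_of_one_lt {q : ℝ} (hq : 1 < q) :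
    ∃ C : ℝ, 0 ≤ C ∧ FunctionalRateSupBound (d := Fin 3) (torusVorticityMoment q) C := by
  obtain ⟨K₁, hK₁0, hK₁⟩ := exists_cz_rpow (q := q) (by linarith)
  have hq0 : 0 < q := by linarith
  obtain ⟨C, hC⟩ : ∃ C : ℝ, C = q * (Real.sqrt 2 * K₁ ^ (1 / q)) := ⟨_, rfl⟩
  have hC0 : 0 ≤ C := by rw [hC]; positivity
  refine ⟨C, hC0, ?_⟩
  intro _ ν hν a b hab u p hsol t ht M hM hω R hR
  have hu : IsSmoothSpaceTimeOn (Icc a b) u := hsol.smooth_velocity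
  have hF0 : 0 ≤ torusVorticityMoment q (u t) := torusVorticityMoment_nonneg q (u t)
  -- reduction to `R ≤ C (M + δ) Z_q(t)` for every `δ > 0`
  suffices key : ∀ δ : ℝ, 0 < δ → R ≤ C * (M + δ) * torusVorticityMoment q (u t) by
    refine le_of_forall_pos_le_add fun e he => ?_
    have hden : 0 < C * torusVorticityMoment q (u t) + 1 := by positivity
    have h := key (e / (C * torusVorticityMoment q (u t) + 1)) (div_pos he hden)
    have h3 : C * torusVorticityMoment q (u t) / (C * torusVorticityMoment q (u t) + 1) ≤ 1 := by
      rw [div_le_one hden]; linarith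
    have h2 : C * (e / (C * torusVorticityMoment q (u t) + 1)) * torusVorticityMoment q (u t) ≤ e := by
      have e1 : C * (e / (C * torusVorticityMoment q (u t) + 1)) * torusVorticityMoment q (u t) =
          e * (C * torusVorticityMoment q (u t) / (C * torusVorticityMoment q (u t) + 1)) := by
        rw [mul_div_assoc', div_mul_eq_mul_div, mul_div_assoc']
        congr 1; ring
      rw [e1]
      calc e * (C * torusVorticityMoment q (u t) / (C * torusVorticityMoment q (u t) + 1)) ≤ e * 1 :=
            mul_le_mul_of_nonneg_left h3 he.le
        _ = e := mul_one e
    calc R ≤ C * (M + e / (C * torusVorticityMoment q (u t) + 1)) * torusVorticityMoment q (u t) := h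
      _ = C * M * torusVorticityMoment q (u t) +
          C * (e / (C * torusVorticityMoment q (u t) + 1)) * torusVorticityMoment q (u t) := by ring
      _ ≤ C * M * torusVorticityMoment q (u t) + e := by linarith
  intro δ hδ
  -- Step 1: a window `J = [a', b'] ∋ t` on which `|ω|² ≤ (M + δ)²` (tube lemma)
  have hU : UniqueDiffOn ℝ (Icc a b) := uniqueDiffOn_Icc hab
  have hQst : IsSmoothSpaceTimeOn (Icc a b) (fun s y => torusVorticitySqAt (u s) y) := by
    have h : IsSmoothSpaceTimeOn (Icc a b) (fun s y => ∑ i, ∑ j,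
        (partialDeriv i (u s) y j - partialDeriv j (u s) y i) ^ 2) :=
      IsSmoothSpaceTimeOn.sum fun i _ => IsSmoothSpaceTimeOn.sum fun j _ =>
        ContDiffOn.pow (((hu.partialDeriv hU i).apply j).sub ((hu.partialDeriv hU j).apply i)) 2
    have hfun : (fun s y => torusVorticitySqAt (u s) y) = fun s y => (2⁻¹ : ℝ) • ∑ i, ∑ j,
        (partialDeriv i (u s) y j - partialDeriv j (u s) y i) ^ 2 := by
      funext s y; rfl
    rw [hfun]
    exact h.const_smul (2⁻¹ : ℝ)
  have he0 : 0 < δ * (2 * M + δ) := by positivity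
  obtain ⟨η, hη, hηP⟩ := Metric.mem_nhdsWithin_iff.1 (hQst.eventually_norm_sub_lt ht he0)
  obtain ⟨a', ha'⟩ : ∃ a' : ℝ, a' = max a (t - η / 2) := ⟨_, rfl⟩
  obtain ⟨b', hb'⟩ : ∃ b' : ℝ, b' = min b (t + η / 2) := ⟨_, rfl⟩
  have hta' : a' ≤ t := by rw [ha']; exact max_le ht.1 (by linarith)
  have htb' : t ≤ b' := by rw [hb']; exact le_min ht.2 (by linarith)
  have ha'b' : a' < b' := by
    rcases lt_or_eq_of_le ht.2 with htb | htb
    · have : t < b' := by rw [hb']; exact lt_min htb (by linarith)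
      linarith
    · have hat : a < t := by rw [htb]; exact hab
      have : a' < t := by rw [ha']; exact max_lt hat (by linarith)
      linarith
  have hJsub : Icc a' b' ⊆ Icc a b := by
    rw [ha', hb']; exact Icc_subset_Icc (le_max_left _ _) (min_le_left _ _)
  have htJ : t ∈ Icc a' b' := ⟨hta', htb'⟩
  have hJω : ∀ τ ∈ Icc a' b', ∀ x, torusVorticitySqAt (u τ) x ≤ (M + δ) ^ 2 := by
    intro τ hτ x
    have hdist : dist τ t < η := by
      rw [Real.dist_eq, abs_lt]
      have h1 : t - η / 2 ≤ τ := le_trans (by rw [ha']; exact le_max_right _ _) hτ.1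
      have h2 : τ ≤ t + η / 2 := le_trans hτ.2 (by rw [hb']; exact min_le_right _ _)
      constructor <;> linarith
    have h' : ∀ y, ‖torusVorticitySqAt (u τ) y - torusVorticitySqAt (u t) y‖ < δ * (2 * M + δ) :=
      hηP ⟨hdist, hJsub hτ⟩
    have h := h' x
    rw [Real.norm_eq_abs, abs_lt] at h
    have h2 := hω x
    nlinarith [h.2, h2]
  have hJmem : Icc a' b' ∈ 𝓝[Icc a b] t := by
    have h1 : Icc a b ∩ Metric.ball t (η / 2) ∈ 𝓝[Icc a b] t :=
      inter_mem_nhdsWithin _ (Metric.ball_mem_nhds t (half_pos hη))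
    refine mem_of_superset h1 fun s hs => ?_
    have hd : dist s t < η / 2 := hs.2
    rw [Real.dist_eq, abs_lt] at hd
    rw [ha', hb']
    exact ⟨max_le hs.1.1 (by linarith), le_min hs.1.2 (by linarith)⟩
  -- Step 2: the solution on `J` and `Ḟ_ε ≤ C(M+δ)F_ε` there
  have hsolJ := hsol.mono hJsub (uniqueDiffOn_Icc ha'b')
  have hMδ : 0 ≤ M + δ := by linarith
  have hreg : ∀ ε : ℝ, 0 < ε → ∀ τ ∈ Icc a' b', ∃ D : ℝ,
      HasDerivWithinAt (fun s => ∫ x, (torusVorticitySqAt (u s) x + ε) ^ (q / 2)) D (Icc a' b') τ ∧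
        D ≤ C * (M + δ) * ∫ x, (torusVorticitySqAt (u τ) x + ε) ^ (q / 2) := by
    intro ε hε τ hτ
    obtain ⟨D, hD, hle⟩ := reg_hasDerivWithinAt_le hq hK₁0 hK₁ ha'b' hν hsolJ hMδ hJω hε hτ
    refine ⟨D, hD, ?_⟩
    calc D ≤ q * (Real.sqrt 2 * K₁ ^ (1 / q)) * (M + δ) *
        ∫ x, (torusVorticitySqAt (u τ) x + ε) ^ (q / 2) := hle
      _ = C * (M + δ) * ∫ x, (torusVorticitySqAt (u τ) x + ε) ^ (q / 2) := by rw [hC]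
  -- Step 3: Grönwall for `F_ε` on `J`, then `ε → 0⁺`
  have hcont : ∀ τ ∈ Icc a b, Continuous fun ε : ℝ =>
      ∫ x, (torusVorticitySqAt (u τ) x + ε) ^ (q / 2) := fun τ hτ =>
    continuous_integral_add_rpow (continuous_vorticitySqAt (hu.isSmooth_slice hτ)) (by linarith)
  have hF_eq : ∀ τ, (∫ x, (torusVorticitySqAt (u τ) x + 0) ^ (q / 2)) =
      torusVorticityMoment q (u τ) := by
    intro τ; simp only [add_zero]; rfl
  have hup : ∀ s ∈ Icc a' b', t ≤ s →
      torusVorticityMoment q (u s) ≤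
        Real.exp (C * (M + δ) * (s - t)) * torusVorticityMoment q (u t) := by
    intro s hs hts
    have h := le_of_forall_pos_le_of_continuousAt
      (A := fun ε => ∫ x, (torusVorticitySqAt (u s) x + ε) ^ (q / 2))
      (B := fun ε => Real.exp (C * (M + δ) * (s - t)) *
        ∫ x, (torusVorticitySqAt (u t) x + ε) ^ (q / 2))
      (hcont s (hJsub hs)).continuousAt (continuous_const.mul (hcont t ht)).continuousAt
      (fun ε hε _ => exp_bound_of_deriv_le ha'b' (hreg ε hε) htJ hs hts)
    simpa only [hF_eq] using h
  have hdown : ∀ s ∈ Icc a' b', s ≤ t →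
      torusVorticityMoment q (u t) ≤
        Real.exp (C * (M + δ) * (t - s)) * torusVorticityMoment q (u s) := by
    intro s hs hst
    have h := le_of_forall_pos_le_of_continuousAt
      (A := fun ε => ∫ x, (torusVorticitySqAt (u t) x + ε) ^ (q / 2))
      (B := fun ε => Real.exp (C * (M + δ) * (t - s)) *
        ∫ x, (torusVorticitySqAt (u s) x + ε) ^ (q / 2))
      (hcont t ht).continuousAt (continuous_const.mul (hcont s (hJsub hs))).continuousAt
      (fun ε hε _ => exp_bound_of_deriv_le ha'b' (hreg ε hε) hs htJ hst)
    simpa only [hF_eq] using h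
  -- Step 4: slopes
  exact le_of_exp_bounds hab ht hR hJmem hup hdown

/-- **Row `E.q=3/2|T_C|C1` (kernel, control):** `∃ C ≥ 0, FunctionalRateSupBound (torusVorticityMoment (3/2)) C`
on `T³` — the singular-weight vorticity row, by regularisation. [ours] -/
theorem functionalRateSupBound_three_halves :
    ∃ C : ℝ, 0 ≤ C ∧ FunctionalRateSupBound (d := Fin 3) (torusVorticityMoment (3 / 2)) C :=
  functionalRateSupBound_of_one_lt (by norm_num)

end VorticityMoment

end Summit.NavierStokesRegularity.FunctionalMining

end
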